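import Summits.ValiantsHypothesis.ValiantsHypothesis.Theorems.LacunarySymmetroidMatrixDescartesVSQTriPoints0

/-!
# `MatrixDescartes` census, `m = 3` row — SIGNS of the tridiagonal determinant `E3` at the test points, II: levels `1` and `2`

HONEST FRAMING.  Val-V1-extremal engine seat val-v1x-eng-6 (g2), `--supports stmt-ValiantsHypothesis-18050` (helper); continuation of
`…VSQTriPoints0` (same conventions: `P₀ = fa(t)`, `P₁ = (−1)^n fa(u)`, `P₂ = (−1)^n fc(u)`, `Q₀ = B^{−δ} fb(t)`, `Q₁ = fb(u)`,
`u = B^{−σ} t`, `B ≥ 16K²`).  Level `1`: `P₀` sits on its top term and the finished link `0` is weak while `P₁, Q₁` run the `m = 2`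
programme in the delayed variable `u` (`sign3_L1U`, `sign3_L1W`, `sign3_L1I` — the last at the bracketed zeros of `Q₁`, square
splitting); level `2`: `P₂`'s chain (`sign3_L2`).  The count is assembled in `…VSQTriLaw`.  Nothing here bears on the crux
`MatrixDescartes` (stmt-18050, asymptotic) or on `VP ≠ VNP`.
[folklore] Viro patchworking / dominance; intermediate value theorem.
-/

set_option linter.dupNamespace false
set_option autoImplicit false

namespace Summit.ValiantsHypothesis.ValiantsHypothesis.Theorems.LacunarySymmetroidMatrixDescartes.VSQ

open scoped BigOperators
open Finset

variable {n : ℕ} {B : ℝ}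

/-! ## 1. Level 1 -/

/-- **level 1, U-points** (`t = B^{σ + y}`, `u = B^y`, `y ≤ 2n − 1`; `a_{n+1}` on top, `a_{l1}(u)` dominant, both links weak). [folklore] -/
theorem sign3_L1U (hn : 2 ≤ n) (hB : 16 * ((n + 2 : ℕ) : ℝ) ^ 2 ≤ B) {y : ℤ} (hy0 : -1 ≤ y) (hy : y ≤ 2 * (n : ℤ) - 1)
    (l1 : Fin (n + 2)) (Ha : ∀ l : Fin (n + 2), l ≠ l1 → ea n l y + 1 ≤ ea n l1 y) (Hq : qa n ≤ ea n l1 y)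
    (Hg1 : 2 * eb n 1 y + 1 ≤ ea n l1 y + ec n 0 y) :
    0 < (saF n (Fin.last (n + 1)) * ((-1) ^ n * saF n l1) * ((-1) ^ n * scF n 0)) * E3 n B (B ^ ((sg n : ℤ) + y)) := by
  obtain ⟨hB1, h8, -⟩ := hB16 hB
  have hB0 : 0 < B := lt_trans zero_lt_one hB1
  have hn' : (2 : ℤ) ≤ n := by exact_mod_cast hn
  set x : ℤ := (sg n : ℤ) + y with hx
  have hx3 : 4 * (n : ℤ) + 3 ≤ x := by rw [hx, sg_cast]; linarith
  have htx : (0 : ℝ) < B ^ x := zpow_pos hB0 _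
  have hty : (0 : ℝ) < B ^ y := zpow_pos hB0 _
  unfold E3
  rw [u_zpow hB0, show x - sg n = y by rw [hx]; ring]
  have cP0 := cert_of_dom h8 hB0 (fun l => abs_saR_le n l) (haF n) (dF n) htx (Fin.last (n + 1))
    (domA_top hn hB hx3 le_rfl)
  have cP1 := cert_smul (abs_neg_one_pow' n) (cert_of_dom h8 hB0 (fun l => abs_saR_le n l) (haF n) (dF n) hty l1
    (dom_zpow hB1 _ _ _ y l1 fun l hl => Or.inr (Ha l hl)))
  have cP2 := cert_smul (abs_neg_one_pow' n) (cert_of_dom h8 hB0 (fun l => abs_scR_le n l) (hcF n) (dF n) hty 0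
    (domC_low hn hB hty le_rfl (by linarith)))
  have bQ0 := abs_zsmul_le (zpow_pos hB0 (-(dlt n : ℤ))) (abs_bnom_le hB0 (fun l => abs_sbR_le n l) (hbF n) (dF n) htx
    (zpow_pos hB0 _).le (belowB_high hB (x := x) (by linarith) htx.le le_rfl))
  have bQ1 := abs_bnom_le hB0 (fun l => abs_sbR_le n l) (hbF n) (dF n) hty (zpow_pos hB0 _).le
    (belowB_low hB (y := y) (by linarith) hty.le le_rfl)
  have g0 : 16 * (B ^ (-(dlt n : ℤ)) * (((n + 2 : ℕ) : ℝ) * B ^ (eb n n x))) ^ 2 ≤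
      tv B (haF n (Fin.last (n + 1))) (dF n (Fin.last (n + 1))) (B ^ x) * tv B (haF n l1) (dF n l1) (B ^ y) := by
    rw [q0_reshape hB0, tv_ea hB0, tv_ea hB0]
    exact pow_gap16 hB1 hB (by have := gap0_late hn hx3; simp only [Fin.val_last] at this ⊢; linarith)
  have g1 : 16 * (((n + 2 : ℕ) : ℝ) * B ^ (eb n 1 y)) ^ 2 ≤ tv B (haF n l1) (dF n l1) (B ^ y) * tv B (hcF n 0) (dF n 0) (B ^ y) := by
    rw [tv_ea hB0, tv_ec hB0]
    exact pow_gap16 hB1 hB (by simp only [Fin.val_zero]; linarith)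
  have hs0 : |saF n (Fin.last (n + 1))| = 1 := abs_saR_eq n _
  have hs1 : |(-1 : ℝ) ^ n * saF n l1| = 1 := by rw [abs_mul, abs_neg_one_pow', abs_saF_eq, one_mul]
  have hs2 : |(-1 : ℝ) ^ n * scF n 0| = 1 := by rw [abs_mul, abs_neg_one_pow', abs_scF_eq, one_mul]
  exact U3_real (tv_pos hB0 _ _ htx) (tv_pos hB0 _ _ hty) (tv_pos hB0 _ _ hty) hs0 hs1 hs2 cP0 cP1 cP2 bQ0 bQ1 g0 g1

/-- **level 1, W-points** `y = 2n + 2w − 1` (link `1` strong, link `0` weak): `E3 < 0`. [folklore] -/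
theorem sign3_L1W (hn : 2 ≤ n) (hB : 16 * ((n + 2 : ℕ) : ℝ) ^ 2 ≤ B) {w : ℕ} (hw1 : 1 ≤ w) (hwn : w ≤ n) :
    0 < -(saF n (Fin.last (n + 1))) * E3 n B (B ^ ((sg n : ℤ) + (2 * (n : ℤ) + 2 * w - 1))) := by
  obtain ⟨hB1, h8, -⟩ := hB16 hB
  have hB0 : 0 < B := lt_trans zero_lt_one hB1
  have hn' : (2 : ℤ) ≤ n := by exact_mod_cast hn
  have hw1' : (1 : ℤ) ≤ w := by exact_mod_cast hw1
  have hwn' : (w : ℤ) ≤ n := by exact_mod_cast hwn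
  set y : ℤ := 2 * (n : ℤ) + 2 * w - 1 with hy
  set x : ℤ := (sg n : ℤ) + y with hx
  have hx3 : 4 * (n : ℤ) + 3 ≤ x := by rw [hx, hy, sg_cast]; linarith
  have htx : (0 : ℝ) < B ^ x := zpow_pos hB0 _
  have hty : (0 : ℝ) < B ^ y := zpow_pos hB0 _
  unfold E3
  rw [u_zpow hB0, show x - sg n = y by rw [hx]; ring]
  have hsw : |sbF n ⟨w, by omega⟩| = 1 := by show |sbR n w| = 1; exact abs_sbR_blk hw1 hwn
  -- strong link: Q₁ = b(u) at w
  have cQ1 := cert_of_dom h8 hB0 (fun l => abs_sbR_le n l) (hbF n) (dF n) hty ⟨w, by omega⟩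
    (dom_zpow hB1 _ _ _ y ⟨w, by omega⟩ fun l hl => by
      rcases cases_v (val_le l) with h0 | ⟨h1, h2⟩ | htop
      · exact Or.inl (sbR_off (Or.inl h0))
      · exact Or.inr (eb_blk_dom hw1 hwn h1 h2 (fun h => hl (Fin.ext h)))
      · exact Or.inl (sbR_off (Or.inr htop)))
  -- far diagonal: P₀ on its top term
  have cP0 := cert_of_dom h8 hB0 (fun l => abs_saR_le n l) (haF n) (dF n) htx (Fin.last (n + 1)) (domA_top hn hB hx3 le_rfl)
  -- bounds
  have bP2 := abs_smul_le (abs_neg_one_pow' n) (abs_bnom_le hB0 (fun l => abs_scR_le n l) (hcF n) (dF n) hty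
    (zpow_pos hB0 (ec n 0 y)).le (below_zpow hB1 _ _ _ y _ fun l => Or.inr (by
      change ec n l y ≤ ec n 0 y
      by_cases hl : (l : ℕ) = 0
      · rw [hl]
      · linarith [ec_low_dom (x := y) hn (Nat.one_le_iff_ne_zero.2 hl) (val_le l) (by linarith)])))
  have bP1 := abs_smul_le (abs_neg_one_pow' n) (abs_bnom_le hB0 (fun l => abs_saR_le n l) (haF n) (dF n) hty
    (zpow_pos hB0 (ea n n y)).le (below_zpow hB1 _ _ _ y _ fun l => Or.inr (by
      change ea n l y ≤ ea n n y
      by_cases hl : (l : ℕ) = n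
      · rw [hl]
      · linarith [ea_n_dom hn hw1 hwn (val_le l) hl])))
  have bQ0 := abs_zsmul_le (zpow_pos hB0 (-(dlt n : ℤ))) (abs_bnom_le hB0 (fun l => abs_sbR_le n l) (hbF n) (dF n) htx
    (zpow_pos hB0 _).le (belowB_high hB (x := x) (by linarith) htx.le le_rfl))
  -- gaps
  have gs : 16 * ((((n + 2 : ℕ) : ℝ) * B ^ (ec n 0 y)) * (((n + 2 : ℕ) : ℝ) * B ^ (ea n n y))) ≤
      (tv B (hbF n ⟨w, by omega⟩) (dF n ⟨w, by omega⟩) (B ^ y)) ^ 2 := by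
    rw [tv_eb hB0]
    exact pow_gap16' hB1 hB (by have h1 := gap_W hn hw1 hwn; have h2 := ec_zero n y; linarith)
  have gw : 16 * (B ^ (-(dlt n : ℤ)) * (((n + 2 : ℕ) : ℝ) * B ^ (eb n n x))) ^ 2 ≤
      (((n + 2 : ℕ) : ℝ) * B ^ (ea n n y)) * tv B (haF n (Fin.last (n + 1))) (dF n (Fin.last (n + 1))) (B ^ x) := by
    rw [q0_reshape hB0, tv_ea hB0]
    have hK1 : (1 : ℝ) ≤ ((n + 2 : ℕ) : ℝ) := by exact_mod_cast (show 1 ≤ n + 2 by omega)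
    calc 16 * (((n + 2 : ℕ) : ℝ) * B ^ (eb n n x - dlt n)) ^ 2 ≤ B ^ (ea n n y) * B ^ (ea n ((Fin.last (n + 1) : Fin (n + 2)) : ℕ) x) :=
          pow_gap16 hB1 hB (by
            have h1 := gap0_late hn hx3; have h2 := qa_lt_ea_n hn hw1 hwn
            simp only [Fin.val_last]; linarith)
      _ ≤ _ := mul_le_mul_of_nonneg_right (le_mul_of_one_le_left (zpow_pos hB0 _).le hK1) (zpow_pos hB0 _).le
  have hs0 : |saF n (Fin.last (n + 1))| = 1 := abs_saR_eq n _
  have h := W3_real (tv_pos hB0 _ _ hty) (tv_pos hB0 _ _ htx) hsw hs0 cQ1 cP0 bP2 bP1 bQ0 (by positivity) gs gw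
  have e : -(saF n (Fin.last (n + 1))) *
      (fa n B (B ^ x) * ((-1) ^ n * fa n B (B ^ y)) * ((-1) ^ n * fc n B (B ^ y)) -
        (B ^ (-(dlt n : ℤ)) * fb n B (B ^ x)) ^ 2 * ((-1) ^ n * fc n B (B ^ y)) - fb n B (B ^ y) ^ 2 * fa n B (B ^ x)) =
      saF n (Fin.last (n + 1)) * (fb n B (B ^ y) ^ 2 * fa n B (B ^ x) +
        (B ^ (-(dlt n : ℤ)) * fb n B (B ^ x)) ^ 2 * ((-1) ^ n * fc n B (B ^ y)) -
        ((-1) ^ n * fc n B (B ^ y)) * ((-1) ^ n * fa n B (B ^ y)) * fa n B (B ^ x)) := by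
    ring
  rw [e]
  exact h

/-- **level 1, bracketed zero of `Q₁`** (`b(u) = 0`, `B^{2n+2w−1} ≤ u ≤ B^{2n+2w+1}`, `t = B^σ u`): `E3 > 0`. [folklore] -/
theorem sign3_L1I (hn : 2 ≤ n) (hB : 16 * ((n + 2 : ℕ) : ℝ) ^ 2 ≤ B) {w : ℕ} (hw1 : 1 ≤ w) (hwn : w + 1 ≤ n) {u : ℝ}
    (hu1 : B ^ (2 * (n : ℤ) + 2 * w - 1) ≤ u) (hu2 : u ≤ B ^ (2 * (n : ℤ) + 2 * (w + 1 : ℕ) - 1)) (hb : fb n B u = 0) :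
    0 < (saF n (Fin.last (n + 1)) * ((-1) ^ n * saF n ⟨n, by omega⟩) * ((-1) ^ n * scF n 0)) *
      E3 n B (B ^ (sg n : ℤ) * u) := by
  obtain ⟨hB1, h8, hB4⟩ := hB16 hB
  have hB0 : 0 < B := lt_trans zero_lt_one hB1
  have hn' : (2 : ℤ) ≤ n := by exact_mod_cast hn
  have hw1' : (1 : ℤ) ≤ w := by exact_mod_cast hw1
  have hu0 : 0 < u := lt_of_lt_of_le (zpow_pos hB0 _) hu1
  set t : ℝ := B ^ (sg n : ℤ) * u with ht
  have ht0 : 0 < t := mul_pos (zpow_pos hB0 _) hu0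
  set x1 : ℤ := (sg n : ℤ) + 2 * n + 2 * w - 1 with hx1
  set x2 : ℤ := (sg n : ℤ) + 2 * n + 2 * w + 1 with hx2
  have hx13 : 4 * (n : ℤ) + 3 ≤ x1 := by rw [hx1, sg_cast]; linarith
  have ht1 : B ^ x1 ≤ t := by
    rw [ht, hx1, show (sg n : ℤ) + 2 * n + 2 * w - 1 = (sg n : ℤ) + (2 * n + 2 * w - 1) by ring, zpow_add₀ hB0.ne']
    exact mul_le_mul_of_nonneg_left hu1 (zpow_pos hB0 _).le
  have ht2 : t ≤ B ^ x2 := by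
    rw [ht, hx2, show (sg n : ℤ) + 2 * n + 2 * w + 1 = (sg n : ℤ) + (2 * n + 2 * (w + 1 : ℕ) - 1) by push_cast; ring,
      zpow_add₀ hB0.ne']
    exact mul_le_mul_of_nonneg_left hu2 (zpow_pos hB0 _).le
  have hut : B ^ (-(sg n : ℤ)) * t = u := by
    rw [ht, ← mul_assoc, ← zpow_add₀ hB0.ne', neg_add_cancel, zpow_zero, one_mul]
  unfold E3
  rw [hut]
  have cP0 := cert_of_dom h8 hB0 (fun l => abs_saR_le n l) (haF n) (dF n) ht0 (Fin.last (n + 1)) (domA_top hn hB hx13 ht1)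
  have cP1 := cert_smul (abs_neg_one_pow' n) (cert_of_dom h8 hB0 (fun l => abs_saR_le n l) (haF n) (dF n) hu0 ⟨n, by omega⟩
    (domA_bracket hn hB4 hw1 hwn hu1 hu2))
  have cP2 := cert_smul (abs_neg_one_pow' n) (cert_of_dom h8 hB0 (fun l => abs_scR_le n l) (hcF n) (dF n) hu0 0
    (domC_bracket hn hB4 hwn hu0 hu2))
  have bQ0 := abs_zsmul_le (zpow_pos hB0 (-(dlt n : ℤ))) (abs_bnom_le hB0 (fun l => abs_sbR_le n l) (hbF n) (dF n) ht0
    (zpow_pos hB0 _).le (belowB_high hB (x := x2) (by linarith) ht0.le ht2))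
  have bQ1 : |fb n B u| ≤ 0 := by rw [hb, abs_zero]
  have g0 : 16 * (B ^ (-(dlt n : ℤ)) * (((n + 2 : ℕ) : ℝ) * B ^ (eb n n x2))) ^ 2 ≤
      tv B (haF n (Fin.last (n + 1))) (dF n (Fin.last (n + 1))) t * tv B (haF n ⟨n, by omega⟩) (dF n ⟨n, by omega⟩) u := by
    rw [q0_reshape hB0]
    have hl : 16 * (((n + 2 : ℕ) : ℝ) * B ^ (eb n n x2 - dlt n)) ^ 2 ≤
        tv B (haF n (Fin.last (n + 1))) (dF n (Fin.last (n + 1))) (B ^ x1) *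
          tv B (haF n ⟨n, by omega⟩) (dF n ⟨n, by omega⟩) (B ^ (2 * (n : ℤ) + 2 * w - 1)) := by
      rw [tv_ea hB0, tv_ea hB0]
      exact pow_gap16 hB1 hB (by
        have h1 := gap0_bracket1 hn hw1; simp only [Fin.val_last]; rw [hx2, hx1]; linarith)
    exact hl.trans (mul_le_mul (tv_mono hB0 _ _ (zpow_pos hB0 _).le ht1) (tv_mono hB0 _ _ (zpow_pos hB0 _).le hu1)
      (tv_pos hB0 _ _ (zpow_pos hB0 _)).le (tv_pos hB0 _ _ ht0).le)
  have g1 : 16 * (0 : ℝ) ^ 2 ≤ tv B (haF n ⟨n, by omega⟩) (dF n ⟨n, by omega⟩) u * tv B (hcF n 0) (dF n 0) u := by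
    have := mul_pos (tv_pos hB0 (haF n ⟨n, by omega⟩) (dF n ⟨n, by omega⟩) hu0) (tv_pos hB0 (hcF n 0) (dF n 0) hu0)
    simpa using this.le
  have hs0 : |saF n (Fin.last (n + 1))| = 1 := abs_saR_eq n _
  have hs1 : |(-1 : ℝ) ^ n * saF n ⟨n, by omega⟩| = 1 := by rw [abs_mul, abs_neg_one_pow', abs_saF_eq, one_mul]
  have hs2 : |(-1 : ℝ) ^ n * scF n 0| = 1 := by rw [abs_mul, abs_neg_one_pow', abs_scF_eq, one_mul]
  exact U3_real (tv_pos hB0 _ _ ht0) (tv_pos hB0 _ _ hu0) (tv_pos hB0 _ _ hu0) hs0 hs1 hs2 cP0 cP1 cP2 bQ0 bQ1 g0 g1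

/-! ## 2. Level 2 -/

/-- **level 2 points** (`t = B^{σ + y}`, `u = B^y`, `y ≥ 4n + 3`; `a_{n+1}` on top twice, `c_{lc}(u)` dominant). [folklore] -/
theorem sign3_L2 (hn : 2 ≤ n) (hB : 16 * ((n + 2 : ℕ) : ℝ) ^ 2 ≤ B) {y : ℤ} (hy : 4 * (n : ℤ) + 3 ≤ y) (lc : Fin (n + 2))
    (Hc : ∀ l : Fin (n + 2), l ≠ lc → ec n l y + 1 ≤ ec n lc y) (Hg1 : 2 * eb n n y + 1 ≤ ea n (n + 1) y + ec n lc y) :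
    0 < (saF n (Fin.last (n + 1)) * ((-1) ^ n * saF n (Fin.last (n + 1))) * ((-1) ^ n * scF n lc)) *
      E3 n B (B ^ ((sg n : ℤ) + y)) := by
  obtain ⟨hB1, h8, -⟩ := hB16 hB
  have hB0 : 0 < B := lt_trans zero_lt_one hB1
  have hn' : (2 : ℤ) ≤ n := by exact_mod_cast hn
  set x : ℤ := (sg n : ℤ) + y with hx
  have hx3 : 4 * (n : ℤ) + 3 ≤ x := by rw [hx, sg_cast]; linarith
  have htx : (0 : ℝ) < B ^ x := zpow_pos hB0 _
  have hty : (0 : ℝ) < B ^ y := zpow_pos hB0 _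
  unfold E3
  rw [u_zpow hB0, show x - sg n = y by rw [hx]; ring]
  have cP0 := cert_of_dom h8 hB0 (fun l => abs_saR_le n l) (haF n) (dF n) htx (Fin.last (n + 1)) (domA_top hn hB hx3 le_rfl)
  have cP1 := cert_smul (abs_neg_one_pow' n) (cert_of_dom h8 hB0 (fun l => abs_saR_le n l) (haF n) (dF n) hty
    (Fin.last (n + 1)) (domA_top hn hB hy le_rfl))
  have cP2 := cert_smul (abs_neg_one_pow' n) (cert_of_dom h8 hB0 (fun l => abs_scR_le n l) (hcF n) (dF n) hty lc
    (dom_zpow hB1 _ _ _ y lc fun l hl => Or.inr (Hc l hl)))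
  have bQ0 := abs_zsmul_le (zpow_pos hB0 (-(dlt n : ℤ))) (abs_bnom_le hB0 (fun l => abs_sbR_le n l) (hbF n) (dF n) htx
    (zpow_pos hB0 _).le (belowB_high hB (x := x) (by linarith) htx.le le_rfl))
  have bQ1 := abs_bnom_le hB0 (fun l => abs_sbR_le n l) (hbF n) (dF n) hty (zpow_pos hB0 _).le
    (belowB_high hB (x := y) (by linarith) hty.le le_rfl)
  have g0 : 16 * (B ^ (-(dlt n : ℤ)) * (((n + 2 : ℕ) : ℝ) * B ^ (eb n n x))) ^ 2 ≤
      tv B (haF n (Fin.last (n + 1))) (dF n (Fin.last (n + 1))) (B ^ x) *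
        tv B (haF n (Fin.last (n + 1))) (dF n (Fin.last (n + 1))) (B ^ y) := by
    rw [q0_reshape hB0, tv_ea hB0, tv_ea hB0]
    exact pow_gap16 hB1 hB (by
      have h1 := gap0_late hn hx3; have h2 := qa_lt_ea_top hn hy; simp only [Fin.val_last]; linarith)
  have g1 : 16 * (((n + 2 : ℕ) : ℝ) * B ^ (eb n n y)) ^ 2 ≤
      tv B (haF n (Fin.last (n + 1))) (dF n (Fin.last (n + 1))) (B ^ y) * tv B (hcF n lc) (dF n lc) (B ^ y) := by
    rw [tv_ea hB0, tv_ec hB0]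
    exact pow_gap16 hB1 hB (by simp only [Fin.val_last]; linarith)
  have hs0 : |saF n (Fin.last (n + 1))| = 1 := abs_saR_eq n _
  have hs1 : |(-1 : ℝ) ^ n * saF n (Fin.last (n + 1))| = 1 := by rw [abs_mul, abs_neg_one_pow', abs_saF_eq, one_mul]
  have hs2 : |(-1 : ℝ) ^ n * scF n lc| = 1 := by rw [abs_mul, abs_neg_one_pow', abs_scF_eq, one_mul]
  exact U3_real (tv_pos hB0 _ _ htx) (tv_pos hB0 _ _ hty) (tv_pos hB0 _ _ hty) hs0 hs1 hs2 cP0 cP1 cP2 bQ0 bQ1 g0 g1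

end Summit.ValiantsHypothesis.ValiantsHypothesis.Theorems.LacunarySymmetroidMatrixDescartes.VSQ
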